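import Mathlib
import HarnessLib
import Summits.NavierStokesRegularity.NavierStokesRegularity.Theorems.PoloidalWindowDoorLrcModEntireThreadQuarticPin
import Summits.NavierStokesRegularity.NavierStokesRegularity.Theorems.PoloidalWindowDoorLrcModEntireThreadSpaceTimePin
import Summits.NavierStokesRegularity.NavierStokesRegularity.Theorems.PoloidalWindowDoorLrcModEntireMorseLevelRays

/-!
# Route `PoloidalWindowDoor`, item `LrcModEntire` (stmt-NavierStokesRegularity-20428) / crux K2 (stmt-19708) —
# the FLAT threaded hot spot: all pins in the language of `thread_axis` S3′ `stub_threadedThickEmptyFlat`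

LEAD of item 20428 ns-poloidal-K2-p3 g10 (`--supports stmt-NavierStokesRegularity-20428 --as helper`).
The ideator line `thread_axis` (ns-idea-8, `Cruxes/PoloidalWindowRigidity/Lines/thread_axis.lean` v10) leaves as research residue the FLAT-THREADED
thick column S3′, whose non-Morse hypothesis is typed as `∃ e ≠ 0, e 2 = 0 ∧ fderiv ℝ (fun x => fderiv ℝ (fun y => v (-1) y 2) x e) 0 e = 0`.
This file converts that hypothesis into the `iteratedFDeriv` language of the pin files and PACKAGES every free pin of a flat hot spot in S3′'s
own terms (`flatHotSpotPins`): the flat direction is in the kernel of the slice Hessian (so the horizontal Laplacian is the single curvature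
`∂_{e⊥}∂_{e⊥}v₂`, `horizontalTrace_eq_perp`), of the space-time Hessian (`∂ₜ∂ₑv₂ = 0`), the cubic term along `e` vanishes and the quartic one is
signed against `v₂` (`v₂(−1, se, 0) − v₂(−1,0) = (s⁴/24)·D⁴v₂[e⁴] + o(s⁴)` with `v₂·D⁴v₂[e⁴] ≤ 0`).
WHAT THIS IS NOT: not S3′, not a claim about Navier–Stokes regularity — calculus at a hot spot (bears_on LADDER-NS N0, rung N0-LocalTubeDoorPoloidal). [folklore]
-/

noncomputable section

-- the summit and its single sub-problem share the name (CONVENTIONS §1), as in every Theorems file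
set_option linter.dupNamespace false

namespace Summit.NavierStokesRegularity.NavierStokesRegularity.Theorems.PoloidalWindowDoorLrcModEntireThreadFlatHotSpot

open MeasureTheory Set Function Filter Topology
open scoped RealInnerProductSpace InnerProductSpace
open Literature.Analysis Literature.Analysis.FluidPDE Literature.Analysis.UnboundedOperators
open Summit.NavierStokesRegularity.NavierStokesRegularity.Theorems.LocalSineTubeDoorProfileAlignedWindowRigidityAncient
open Summit.NavierStokesRegularity.NavierStokesRegularity.Theorems.PoloidalWindowDoorLrcModEntireThreadQuarticPin
open Summit.NavierStokesRegularity.NavierStokesRegularity.Theorems.PoloidalWindowDoorLrcModEntireThreadSpaceTimePin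
open Summit.NavierStokesRegularity.NavierStokesRegularity.Theorems.PoloidalWindowDoorLrcModEntireMorseLevelRays

/-! ### Dictionary between the two Hessian spellings -/

/-- `D(x ↦ Df(x)e)(y)w = D²f(y)[w,e]` (S3′ spelling ↔ `iteratedFDeriv` spelling). [folklore] -/
theorem fderiv_fderiv_apply_eq_iteratedFDeriv {f : EuclideanSpace ℝ (Fin 3) → ℝ} (hf : ContDiff ℝ 2 f)
    (y e w : EuclideanSpace ℝ (Fin 3)) :
    fderiv ℝ (fun x => fderiv ℝ f x e) y w = iteratedFDeriv ℝ 2 f y ![w, e] := by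
  rw [fderiv_fderiv_apply_const hf y e w, iteratedFDeriv_two_apply]
  simp

/-- A horizontal vector is the combination of the two horizontal coordinate vectors. -/
theorem horizontal_decomp {e : EuclideanSpace ℝ (Fin 3)} (he : e 2 = 0) :
    e = e 0 • EuclideanSpace.single 0 1 + e 1 • EuclideanSpace.single 1 1 := by
  ext i
  fin_cases i <;> simp [he]

/-- **Horizontal trace = the perpendicular curvature** (2×2 linear algebra).  If the symmetric slice Hessian `D²f(0)` kills the horizontal vector
`e` (`D²f(0)[e,w] = 0` for all `w`), then with `e⊥ := (−e₁, e₀, 0)`: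
`‖e‖ₕ² · (∂₀∂₀f + ∂₁∂₁f)(0) = D²f(0)[e⊥,e⊥]`, where `‖e‖ₕ² = e₀² + e₁²`. [folklore] -/
theorem horizontalTrace_eq_perp {f : EuclideanSpace ℝ (Fin 3) → ℝ} (hf : ContDiff ℝ 2 f) {e : EuclideanSpace ℝ (Fin 3)} (he : e 2 = 0)
    (hker : ∀ w : EuclideanSpace ℝ (Fin 3), iteratedFDeriv ℝ 2 f 0 ![e, w] = 0) :
    (e 0 ^ 2 + e 1 ^ 2) * (iteratedFDeriv ℝ 2 f 0 ![EuclideanSpace.single 0 1, EuclideanSpace.single 0 1] +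
        iteratedFDeriv ℝ 2 f 0 ![EuclideanSpace.single 1 1, EuclideanSpace.single 1 1]) =
      iteratedFDeriv ℝ 2 f 0 ![(-e 1) • EuclideanSpace.single 0 1 + e 0 • EuclideanSpace.single 1 1,
        (-e 1) • EuclideanSpace.single 0 1 + e 0 • EuclideanSpace.single 1 1] := by
  have hsymm : IsSymmSndFDerivAt ℝ f 0 := hf.contDiffAt.isSymmSndFDerivAt (by simp)
  set B := fderiv ℝ (fderiv ℝ f) 0 with hB
  have hq : ∀ u u' : EuclideanSpace ℝ (Fin 3), iteratedFDeriv ℝ 2 f 0 ![u, u'] = B u u' := by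
    intro u u'; rw [iteratedFDeriv_two_apply]; simp [hB]
  have h0 : B e (EuclideanSpace.single 0 1) = 0 := by rw [← hq]; exact hker _
  have h1 : B e (EuclideanSpace.single 1 1) = 0 := by rw [← hq]; exact hker _
  rw [horizontal_decomp he] at h0 h1
  simp only [map_add, map_smul, add_apply, FunLike.coe_smul, Pi.smul_apply, smul_eq_mul] at h0 h1
  have h10 : B (EuclideanSpace.single 1 1) (EuclideanSpace.single 0 1) =
      B (EuclideanSpace.single 0 1) (EuclideanSpace.single 1 1) := hsymm _ _
  rw [hq, hq, hq]
  simp only [map_add, map_smul, add_apply, FunLike.coe_smul, Pi.smul_apply, smul_eq_mul, neg_mul]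
  rw [h10] at h0 ⊢
  linear_combination (e 0) * h0 + (e 1) * h1

/-! ### The package -/

section Class

variable {v : ℝ → EuclideanSpace ℝ (Fin 3) → EuclideanSpace ℝ (Fin 3)} {C : ℝ}

/-- **ALL FREE PINS OF A FLAT THREADED HOT SPOT, in S3′'s terms.**  Hypotheses: the class (rate, continuity, (M)), the hot-spot normalisation
`√(−t)|v₂| ≤ |v₂(−1,0)| ≠ 0`, and S3′'s non-Morse hypothesis.  Conclusions, for the flat horizontal direction `e`:
(1) KERNEL of the slice Hessian: `D(x ↦ Dv₂(−1,·)(x)e)(0) w = 0` for every `w ∈ ℝ³` (so also `∂ₑ∂_z v₂ = 0`);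
(2) SINGLE CURVATURE: `(e₀²+e₁²)·Δₕv₂(−1,·)(0) = D²v₂(−1,·)(0)[e⊥,e⊥]`;
(3) CUBIC VANISHES, QUARTIC SIGNED: `D³v₂(−1,·)(0)[e,e,e] = 0`, `v₂(−1,0)·D⁴v₂(−1,·)(0)[e,e,e,e] ≤ 0`;
(4) SPACE-TIME KERNEL: `D²_{(t,x)}v₂(−1,0)[(0,e),U] = 0` for every `U` (so `∂ₜ∂ₑv₂(−1,0) = 0`). [folklore] -/
theorem flatHotSpotPins (hrate : HasTypeITimeDecay C v) (hcont : ContinuousOn (uncurry v) (Iio (0 : ℝ) ×ˢ univ))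
    (hmild : ∀ s t : ℝ, s < t → t < 0 → ∀ x, v t x = heatExtension (v s) (t - s) x - oseenDuhamel 1 s v v t x)
    (hne : v (-1) 0 2 ≠ 0) (hhot : ∀ t < 0, ∀ x, Real.sqrt (-t) * |v t x 2| ≤ |v (-1) 0 2|)
    (hflat : ∃ e : EuclideanSpace ℝ (Fin 3), e ≠ 0 ∧ e 2 = 0 ∧
      fderiv ℝ (fun x => fderiv ℝ (fun y => v (-1) y 2) x e) 0 e = 0) :
    ∃ e : EuclideanSpace ℝ (Fin 3), e ≠ 0 ∧ e 2 = 0 ∧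
      (∀ w : EuclideanSpace ℝ (Fin 3), fderiv ℝ (fun x => fderiv ℝ (fun y => v (-1) y 2) x e) 0 w = 0) ∧
      (e 0 ^ 2 + e 1 ^ 2) * (iteratedFDeriv ℝ 2 (fun y => v (-1) y 2) 0 ![EuclideanSpace.single 0 1, EuclideanSpace.single 0 1] +
          iteratedFDeriv ℝ 2 (fun y => v (-1) y 2) 0 ![EuclideanSpace.single 1 1, EuclideanSpace.single 1 1]) =
        iteratedFDeriv ℝ 2 (fun y => v (-1) y 2) 0 ![(-e 1) • EuclideanSpace.single 0 1 + e 0 • EuclideanSpace.single 1 1,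
          (-e 1) • EuclideanSpace.single 0 1 + e 0 • EuclideanSpace.single 1 1] ∧
      iteratedFDeriv ℝ 3 (fun y => v (-1) y 2) 0 (fun _ => e) = 0 ∧
      v (-1) 0 2 * iteratedFDeriv ℝ 4 (fun y => v (-1) y 2) 0 (fun _ => e) ≤ 0 ∧
      (∀ U : ℝ × EuclideanSpace ℝ (Fin 3), iteratedFDeriv ℝ 2 (fun p : ℝ × EuclideanSpace ℝ (Fin 3) => v p.1 p.2 2)
        ((-1 : ℝ), (0 : EuclideanSpace ℝ (Fin 3))) ![((0 : ℝ), e), U] = 0) := by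
  obtain ⟨e, hne0, he2, hfl⟩ := hflat
  have hfa : ContDiff ℝ 2 (fun y => v (-1) y 2) := by
    have hsl := analyticOnNhd_slice hcont (bdd_of_hasTypeITimeDecay hrate) hmild (by norm_num : (-1 : ℝ) < 0)
    have han : AnalyticOnNhd ℝ (fun y => v (-1) y 2) univ := fun y _ =>
      ((EuclideanSpace.proj (𝕜 := ℝ) (2 : Fin 3)).analyticAt _).comp (hsl y (mem_univ _))
    exact han.contDiff
  have hflat' : iteratedFDeriv ℝ 2 (fun y => v (-1) y 2) 0 ![e, e] = 0 := by
    rw [← fderiv_fderiv_apply_eq_iteratedFDeriv hfa 0 e e]; exact hfl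
  obtain ⟨hker, h3, h4⟩ := threadFlatDirectionPins hrate hcont hmild hne hhot hflat'
  have hsymm : IsSymmSndFDerivAt ℝ (fun y => v (-1) y 2) 0 := hfa.contDiffAt.isSymmSndFDerivAt (by simp)
  have hker' : ∀ w : EuclideanSpace ℝ (Fin 3), fderiv ℝ (fun x => fderiv ℝ (fun y => v (-1) y 2) x e) 0 w = 0 := by
    intro w
    rw [fderiv_fderiv_apply_eq_iteratedFDeriv hfa 0 e w, iteratedFDeriv_two_apply]
    have h := hker w
    rw [iteratedFDeriv_two_apply] at h
    simp only [Matrix.cons_val_zero, Matrix.cons_val_one] at h ⊢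
    rw [hsymm w e]; exact h
  exact ⟨e, hne0, he2, hker', horizontalTrace_eq_perp hfa he2 hker, h3, h4,
    threadSpaceTimeFlatKernel hrate hcont hmild hne hhot hflat'⟩

end Class

end Summit.NavierStokesRegularity.NavierStokesRegularity.Theorems.PoloidalWindowDoorLrcModEntireThreadFlatHotSpot
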